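import Literature.Analysis.FluidPDE.QuasiSelfSimilarMoveSLink00
import Literature.Analysis.FluidPDE.QuasiSelfSimilarMoveSLink01
import Literature.Analysis.FluidPDE.QuasiSelfSimilarMoveSLink02
import Literature.Analysis.FluidPDE.QuasiSelfSimilarMoveSLink03
import Literature.Analysis.FluidPDE.QuasiSelfSimilarMoveSLink04
import Literature.Analysis.FluidPDE.QuasiSelfSimilarMoveSLink05
import Literature.Analysis.FluidPDE.QuasiSelfSimilarMoveSLink06
import Literature.Analysis.FluidPDE.QuasiSelfSimilarMoveSLink07
import Literature.Analysis.FluidPDE.QuasiSelfSimilarMoveSLink08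
import Literature.Analysis.FluidPDE.QuasiSelfSimilarMoveSLink09
import Literature.Analysis.FluidPDE.QuasiSelfSimilarMoveSLink10
import Literature.Analysis.FluidPDE.QuasiSelfSimilarMoveSLink11
import Literature.Analysis.FluidPDE.QuasiSelfSimilarMoveSLink12
import Literature.Analysis.FluidPDE.QuasiSelfSimilarMoveSLink13
import HarnessLib

/-!
# Straight move: the slot list and its tests

Topic `Literature/Analysis/FluidPDE`. Emitted data / kernel certificates of the explicit straight generating
move (`S`) in the typed-chain model, under the contract of `PlanarGeneratorAssembly.lean`
(`acm_compatible_blocks_of_slots`). Generated by the author's emitter from the exact rational design;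
no named facts, every theorem is decided in the kernel or assembled from decided chunks. [folklore]

## References

* G. Alberti, G. Crippa, A. L. Mazzucato, *Exponential self-similar mixing by incompressible
  flows*, J. Amer. Math. Soc. 32 (2019), 445–490, §8 (arXiv:1605.02090).
-/

noncomputable section

namespace Literature.Analysis.FluidPDE.QuasiSelfSimilar.MoveS

open PlanarKinematics QuasiSelfSimilar

/-- The slot list of the straight move (15 phases on `[0, 1]`). [folklore] -/
def L_S : List Slot := [slot00, slot01, slot02, slot03, slot04, slot05, slot06, slot07, slot08, slot09, slot10, slot11, slot12, slot13, slot14]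

/-- The slot-list test of the straight move. [folklore] -/
theorem slotsOKB_S : slotsOKB C_S (genGate .S) (mkRat (3) 200) L_S = true := by
  simp only [L_S, slotsOKB, slot00_okB, slot01_okB, slot02_okB, slot03_okB, slot04_okB, slot05_okB, slot06_okB, slot07_okB, slot08_okB, slot09_okB, slot10_okB, slot11_okB, slot12_okB, slot13_okB, slot14_okB, link00, link01, link02, link03, link04, link05, link06, link07, link08, link09, link10, link11, link12, link13, Bool.and_self]

set_option maxHeartbeats 4000000 in
/-- The end conditions of the straight move. [folklore] -/
theorem endsOKB_S : endsOKB L_S = true := by decide +kernel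

set_option maxHeartbeats 4000000 in
/-- The uniform start of the straight move. [folklore] -/
theorem uniform_S : (headP L_S).uniformB 1 = true := by
  show P00.uniformB 1 = true
  decide +kernel

set_option maxHeartbeats 4000000 in
/-- The global conditions of the gate template datum. [folklore] -/
theorem globalB_S : C_S.globalB = true := by decide +kernel

end Literature.Analysis.FluidPDE.QuasiSelfSimilar.MoveS

end
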